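import Summits.MatrixMultiplication.MatrixMultiplication.Theses.OctonionicLaser
import Summits.MatrixMultiplication.MatrixMultiplication.Theorems.OctonionicLaserDefs
import Summits.MatrixMultiplication.MatrixMultiplication.Theorems.OctonionicLaserOctAsymptoticRankStubOctonionBasis
import Summits.MatrixMultiplication.MatrixMultiplication.Theorems.OctonionicLaserOctSpectralDominanceLaserSpectralStep
import Literature.Computability.AlgebraicComplexity.AsymptoticRankMatMul
import HarnessLib

/-!
# Route OctonionicLaser — crux `OctSpectralDominance` (stmt-MatrixMultiplication-7931), stub
# `stub_octWeightLaser`: the weight-basis laser inequality `2^{3/2} · F(⟨2,2,2⟩)^{3/4} ≤ F(t₈)`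

For the structure tensor `t₈` of the complex octonions (the route's inline term = `octT ℂ` of
`OctonionicLaserDefs.lean`) and EVERY universal spectral point `F` over `ℂ`:

  `3/2 + (3/4) · log₂ F(⟨2,2,2⟩) ≤ log₂ F(t₈)`      (`octWeightLaser`, `stub_octWeightLaser`).

## Proof: a Coppersmith–Winograd structure inside `t₈`

The route's coordinates `(g; i, j)` (grading bit, matrix unit) form a weight basis for the maximal
torus of the autotopy group `Spin(8)·T²` of `t₈`: the support has `32` entries `±1`
(`octTab`) and is tight.  Grade the three slots by the cocharacter
`out: (g;i,j) ↦ [g=0]·1 + [g=1]([j=0]·2)`, `in₁: (g;i,j) ↦ [g=1]·1 + [g=0]([j=1]·2)`,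
`in₂: (g;i,j) ↦ [g=1]·1 + [g=0]([i=0]·2)` (labels in `Fin 3`; parts of dimensions `2, 4, 2`).
Then (`octWeight_support`) the outer support is contained in — in fact equals —
`S = {(a,b,c) ∈ (Fin 3)³ : a + b + c = 3}` (seven triples; tight for `α = β = γ = (· − 1)`), and every
component is a SIGNED matrix tensor along explicit index maps (`octWeight_components`, checked by the
kernel on the integer table `octTab`): the centre `(1,1,1)` (output degree `0`, inputs of degree `1`:
the Cayley–Dickson term `−adj(d)·b`) is `⟨2,2,2⟩`, the six others are `⟨2,2,1⟩, ⟨1,2,2⟩, ⟨2,1,2⟩`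
(two of each).  The spectral laser theorem (`laser_spectral_of_counts`, helper files
`…LaserSpectral{,Step}.lean`) with the distribution `P = c/8`, `c = 2` at the centre and `1` on the six
other blocks, has all three marginals `(1/4, 1/2, 1/4)` (entropy `3/2`, `octWeight_entropy`) and
`B_c = ⟨2^6, 2^6, 2^6⟩ ≥ ⟨2,2,2⟩^{⊗6}`, whence `8 · 3/2 + 6 log₂ F(⟨2,2,2⟩) ≤ 8 log₂ F(t₈)`.

With `ω` in place of `F` this is `3/2 + (3/4)ω ≤ log₂ R̃(t₈)`: crux (i) `R̃(t₈) ≤ 8` alone gives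
`ω = 2` (sharper than the route's `OctLaserBound`, `ω ≤ log₂ R̃(t₈) − 0.918`).

## References

* [BurgisserClausenShokrollahi1997] BCS, *Algebraic Complexity Theory*, Thm. 15.41, Ex. 15.24(7).
* [CoppersmithWinograd1990] D. Coppersmith, S. Winograd, J. Symb. Comput. 9 (1990), §§6–7.
* [Strassen1988] V. Strassen, J. reine angew. Math. 384 (1988), §3.
* [SpringerVeldkamp2000] T. A. Springer, F. D. Veldkamp, *Octonions, Jordan Algebras and Exceptional
  Groups*, Springer 2000, §3.3 (triality, the autotopies of the octonions).
-/

noncomputable section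

open scoped BigOperators
open Finset

-- the tree's namespace `Summit.MatrixMultiplication.MatrixMultiplication.…` repeats a component by design
set_option linter.dupNamespace false

namespace Summit.MatrixMultiplication.MatrixMultiplication.Theorems

open Literature.Computability.AlgebraicComplexity
open OctonionicLaser (octT octTab)
open OctAsymptoticRank (octT_complex_eq_octTab)

/-! ## The data of the weight grading (closed terms, as local notations) -/

-- Block labels of the three slots (output; first input; second input), values in `Fin 3`.
set_option quotPrecheck false in
local notation "bI₈" =>
  (fun a : Fin 2 × Fin 2 × Fin 2 => (if a.1 = 0 then 1 else (if a.2.2 = 0 then 2 else 0) : Fin 3))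
set_option quotPrecheck false in
local notation "bJ₈" =>
  (fun a : Fin 2 × Fin 2 × Fin 2 => (if a.1 = 1 then 1 else (if a.2.2 = 0 then 0 else 2) : Fin 3))
set_option quotPrecheck false in
local notation "bL₈" =>
  (fun a : Fin 2 × Fin 2 × Fin 2 => (if a.1 = 1 then 1 else (if a.2.1 = 0 then 2 else 0) : Fin 3))
-- The outer support: label triples summing to `3` (seven of them).
set_option quotPrecheck false in
local notation "S₈" =>
  (Finset.univ.filter (fun s : Fin 3 × Fin 3 × Fin 3 => (s.1 : ℕ) + s.2.1 + s.2.2 = 3))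
-- Formats `⟨k, m, n⟩` of the components, as functions of the label triple `(a, b, c)`:
-- `(0,1,2) ↦ ⟨2,2,1⟩, (0,2,1) ↦ ⟨1,2,2⟩, (1,0,2) ↦ ⟨2,1,2⟩, (1,1,1) ↦ ⟨2,2,2⟩, (1,2,0) ↦ ⟨2,1,2⟩,
-- (2,0,1) ↦ ⟨1,2,2⟩, (2,1,0) ↦ ⟨2,2,1⟩` (values off `S₈` are irrelevant).
set_option quotPrecheck false in
local notation "k₈" => (fun s : Fin 3 × Fin 3 × Fin 3 =>
  (if ((s.1 : ℕ) = 0 ∧ (s.2.1 : ℕ) = 2) ∨ ((s.1 : ℕ) = 2 ∧ (s.2.1 : ℕ) = 0) then 1 else 2 : ℕ))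
set_option quotPrecheck false in
local notation "m₈" => (fun s : Fin 3 × Fin 3 × Fin 3 =>
  (if (s.1 : ℕ) = 1 ∧ ((s.2.1 : ℕ) = 0 ∨ (s.2.1 : ℕ) = 2) then 1 else 2 : ℕ))
set_option quotPrecheck false in
local notation "n₈" => (fun s : Fin 3 × Fin 3 × Fin 3 =>
  (if (s.2.1 : ℕ) = 1 ∧ ((s.1 : ℕ) = 0 ∨ (s.1 : ℕ) = 2) then 1 else 2 : ℕ))
-- Index maps of the components: tables over `(a, b, c)` and the two matrix indices (only their values
-- `0/1` are used; entries of blocks off `S₈` or out of range are dummies `(0,0,0)`), generated outside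
-- Lean from the weight analysis and VERIFIED below by the kernel (`octWeight_components`).
set_option quotPrecheck false in
local notation "eIT₈" =>
  (![
    ![
      ![![![(0, 0, 0), (0, 0, 0)], ![(0, 0, 0), (0, 0, 0)]], ![![(0, 0, 0), (0, 0, 0)], ![(0, 0, 0), (0, 0, 0)]], ![![(0, 0, 0), (0, 0, 0)], ![(0, 0, 0), (0, 0, 0)]]],
      ![![![(0, 0, 0), (0, 0, 0)], ![(0, 0, 0), (0, 0, 0)]], ![![(0, 0, 0), (0, 0, 0)], ![(0, 0, 0), (0, 0, 0)]], ![![(1, 0, 1), (0, 0, 0)], ![(1, 1, 1), (0, 0, 0)]]],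
      ![![![(0, 0, 0), (0, 0, 0)], ![(0, 0, 0), (0, 0, 0)]], ![![(1, 0, 1), (1, 1, 1)], ![(0, 0, 0), (0, 0, 0)]], ![![(0, 0, 0), (0, 0, 0)], ![(0, 0, 0), (0, 0, 0)]]]],
    ![
      ![![![(0, 0, 0), (0, 0, 0)], ![(0, 0, 0), (0, 0, 0)]], ![![(0, 0, 0), (0, 0, 0)], ![(0, 0, 0), (0, 0, 0)]], ![![(0, 0, 0), (0, 0, 1)], ![(0, 1, 0), (0, 1, 1)]]],
      ![![![(0, 0, 0), (0, 0, 0)], ![(0, 0, 0), (0, 0, 0)]], ![![(0, 0, 0), (0, 1, 0)], ![(0, 0, 1), (0, 1, 1)]], ![![(0, 0, 0), (0, 0, 0)], ![(0, 0, 0), (0, 0, 0)]]],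
      ![![![(0, 0, 0), (0, 0, 1)], ![(0, 1, 0), (0, 1, 1)]], ![![(0, 0, 0), (0, 0, 0)], ![(0, 0, 0), (0, 0, 0)]], ![![(0, 0, 0), (0, 0, 0)], ![(0, 0, 0), (0, 0, 0)]]]],
    ![
      ![![![(0, 0, 0), (0, 0, 0)], ![(0, 0, 0), (0, 0, 0)]], ![![(1, 0, 0), (1, 1, 0)], ![(0, 0, 0), (0, 0, 0)]], ![![(0, 0, 0), (0, 0, 0)], ![(0, 0, 0), (0, 0, 0)]]],
      ![![![(1, 0, 0), (0, 0, 0)], ![(1, 1, 0), (0, 0, 0)]], ![![(0, 0, 0), (0, 0, 0)], ![(0, 0, 0), (0, 0, 0)]], ![![(0, 0, 0), (0, 0, 0)], ![(0, 0, 0), (0, 0, 0)]]],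
      ![![![(0, 0, 0), (0, 0, 0)], ![(0, 0, 0), (0, 0, 0)]], ![![(0, 0, 0), (0, 0, 0)], ![(0, 0, 0), (0, 0, 0)]], ![![(0, 0, 0), (0, 0, 0)], ![(0, 0, 0), (0, 0, 0)]]]]] : Fin 3 → Fin 3 → Fin 3 → Fin 2 → Fin 2 → Fin 2 × Fin 2 × Fin 2)
set_option quotPrecheck false in
local notation "eJT₈" =>
  (![
    ![
      ![![![(0, 0, 0), (0, 0, 0)], ![(0, 0, 0), (0, 0, 0)]], ![![(0, 0, 0), (0, 0, 0)], ![(0, 0, 0), (0, 0, 0)]], ![![(0, 0, 0), (0, 0, 0)], ![(0, 0, 0), (0, 0, 0)]]],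
      ![![![(0, 0, 0), (0, 0, 0)], ![(0, 0, 0), (0, 0, 0)]], ![![(0, 0, 0), (0, 0, 0)], ![(0, 0, 0), (0, 0, 0)]], ![![(1, 0, 0), (1, 0, 1)], ![(1, 1, 0), (1, 1, 1)]]],
      ![![![(0, 0, 0), (0, 0, 0)], ![(0, 0, 0), (0, 0, 0)]], ![![(0, 0, 1), (0, 1, 1)], ![(0, 0, 0), (0, 0, 0)]], ![![(0, 0, 0), (0, 0, 0)], ![(0, 0, 0), (0, 0, 0)]]]],
    ![
      ![![![(0, 0, 0), (0, 0, 0)], ![(0, 0, 0), (0, 0, 0)]], ![![(0, 0, 0), (0, 0, 0)], ![(0, 0, 0), (0, 0, 0)]], ![![(0, 0, 0), (0, 0, 0)], ![(0, 1, 0), (0, 0, 0)]]],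
      ![![![(0, 0, 0), (0, 0, 0)], ![(0, 0, 0), (0, 0, 0)]], ![![(1, 0, 0), (1, 1, 0)], ![(1, 0, 1), (1, 1, 1)]], ![![(0, 0, 0), (0, 0, 0)], ![(0, 0, 0), (0, 0, 0)]]],
      ![![![(0, 0, 1), (0, 0, 0)], ![(0, 1, 1), (0, 0, 0)]], ![![(0, 0, 0), (0, 0, 0)], ![(0, 0, 0), (0, 0, 0)]], ![![(0, 0, 0), (0, 0, 0)], ![(0, 0, 0), (0, 0, 0)]]]],
    ![
      ![![![(0, 0, 0), (0, 0, 0)], ![(0, 0, 0), (0, 0, 0)]], ![![(0, 0, 0), (0, 1, 0)], ![(0, 0, 0), (0, 0, 0)]], ![![(0, 0, 0), (0, 0, 0)], ![(0, 0, 0), (0, 0, 0)]]],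
      ![![![(1, 0, 0), (1, 0, 1)], ![(1, 1, 0), (1, 1, 1)]], ![![(0, 0, 0), (0, 0, 0)], ![(0, 0, 0), (0, 0, 0)]], ![![(0, 0, 0), (0, 0, 0)], ![(0, 0, 0), (0, 0, 0)]]],
      ![![![(0, 0, 0), (0, 0, 0)], ![(0, 0, 0), (0, 0, 0)]], ![![(0, 0, 0), (0, 0, 0)], ![(0, 0, 0), (0, 0, 0)]], ![![(0, 0, 0), (0, 0, 0)], ![(0, 0, 0), (0, 0, 0)]]]]] : Fin 3 → Fin 3 → Fin 3 → Fin 2 → Fin 2 → Fin 2 × Fin 2 × Fin 2)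
set_option quotPrecheck false in
local notation "eLT₈" =>
  (![
    ![
      ![![![(0, 0, 0), (0, 0, 0)], ![(0, 0, 0), (0, 0, 0)]], ![![(0, 0, 0), (0, 0, 0)], ![(0, 0, 0), (0, 0, 0)]], ![![(0, 0, 0), (0, 0, 0)], ![(0, 0, 0), (0, 0, 0)]]],
      ![![![(0, 0, 0), (0, 0, 0)], ![(0, 0, 0), (0, 0, 0)]], ![![(0, 0, 0), (0, 0, 0)], ![(0, 0, 0), (0, 0, 0)]], ![![(0, 0, 1), (0, 0, 0)], ![(0, 0, 0), (0, 0, 0)]]],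
      ![![![(0, 0, 0), (0, 0, 0)], ![(0, 0, 0), (0, 0, 0)]], ![![(1, 0, 0), (1, 1, 0)], ![(1, 0, 1), (1, 1, 1)]], ![![(0, 0, 0), (0, 0, 0)], ![(0, 0, 0), (0, 0, 0)]]]],
    ![
      ![![![(0, 0, 0), (0, 0, 0)], ![(0, 0, 0), (0, 0, 0)]], ![![(0, 0, 0), (0, 0, 0)], ![(0, 0, 0), (0, 0, 0)]], ![![(0, 0, 0), (0, 0, 1)], ![(0, 0, 0), (0, 0, 0)]]],
      ![![![(0, 0, 0), (0, 0, 0)], ![(0, 0, 0), (0, 0, 0)]], ![![(1, 1, 1), (1, 1, 0)], ![(1, 0, 1), (1, 0, 0)]], ![![(0, 0, 0), (0, 0, 0)], ![(0, 0, 0), (0, 0, 0)]]],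
      ![![![(0, 1, 0), (0, 1, 1)], ![(0, 0, 0), (0, 0, 0)]], ![![(0, 0, 0), (0, 0, 0)], ![(0, 0, 0), (0, 0, 0)]], ![![(0, 0, 0), (0, 0, 0)], ![(0, 0, 0), (0, 0, 0)]]]],
    ![
      ![![![(0, 0, 0), (0, 0, 0)], ![(0, 0, 0), (0, 0, 0)]], ![![(1, 0, 0), (1, 1, 0)], ![(1, 0, 1), (1, 1, 1)]], ![![(0, 0, 0), (0, 0, 0)], ![(0, 0, 0), (0, 0, 0)]]],
      ![![![(0, 1, 1), (0, 0, 0)], ![(0, 1, 0), (0, 0, 0)]], ![![(0, 0, 0), (0, 0, 0)], ![(0, 0, 0), (0, 0, 0)]], ![![(0, 0, 0), (0, 0, 0)], ![(0, 0, 0), (0, 0, 0)]]],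
      ![![![(0, 0, 0), (0, 0, 0)], ![(0, 0, 0), (0, 0, 0)]], ![![(0, 0, 0), (0, 0, 0)], ![(0, 0, 0), (0, 0, 0)]], ![![(0, 0, 0), (0, 0, 0)], ![(0, 0, 0), (0, 0, 0)]]]]] : Fin 3 → Fin 3 → Fin 3 → Fin 2 → Fin 2 → Fin 2 × Fin 2 × Fin 2)
set_option quotPrecheck false in
local notation "σIT₈" =>
  (![
    ![
      ![![![1, 1], ![1, 1]], ![![1, 1], ![1, 1]], ![![1, 1], ![1, 1]]],
      ![![![1, 1], ![1, 1]], ![![1, 1], ![1, 1]], ![![1, 1], ![1, 1]]],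
      ![![![1, 1], ![1, 1]], ![![1, 1], ![1, 1]], ![![1, 1], ![1, 1]]]],
    ![
      ![![![1, 1], ![1, 1]], ![![1, 1], ![1, 1]], ![![1, 1], ![1, 1]]],
      ![![![1, 1], ![1, 1]], ![![1, -1], ![1, -1]], ![![1, 1], ![1, 1]]],
      ![![![1, 1], ![1, 1]], ![![1, 1], ![1, 1]], ![![1, 1], ![1, 1]]]],
    ![
      ![![![1, 1], ![1, 1]], ![![1, 1], ![1, 1]], ![![1, 1], ![1, 1]]],
      ![![![-1, 1], ![-1, 1]], ![![1, 1], ![1, 1]], ![![1, 1], ![1, 1]]],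
      ![![![1, 1], ![1, 1]], ![![1, 1], ![1, 1]], ![![1, 1], ![1, 1]]]]] : Fin 3 → Fin 3 → Fin 3 → Fin 2 → Fin 2 → ℤ)
set_option quotPrecheck false in
local notation "σJT₈" =>
  (![
    ![
      ![![![1, 1], ![1, 1]], ![![1, 1], ![1, 1]], ![![1, 1], ![1, 1]]],
      ![![![1, 1], ![1, 1]], ![![1, 1], ![1, 1]], ![![-1, 1], ![-1, 1]]],
      ![![![1, 1], ![1, 1]], ![![1, 1], ![1, 1]], ![![1, 1], ![1, 1]]]],
    ![
      ![![![1, 1], ![1, 1]], ![![1, 1], ![1, 1]], ![![1, 1], ![1, 1]]],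
      ![![![1, 1], ![1, 1]], ![![-1, 1], ![-1, 1]], ![![1, 1], ![1, 1]]],
      ![![![1, 1], ![1, 1]], ![![1, 1], ![1, 1]], ![![1, 1], ![1, 1]]]],
    ![
      ![![![1, 1], ![1, 1]], ![![1, 1], ![1, 1]], ![![1, 1], ![1, 1]]],
      ![![![-1, 1], ![-1, 1]], ![![1, 1], ![1, 1]], ![![1, 1], ![1, 1]]],
      ![![![1, 1], ![1, 1]], ![![1, 1], ![1, 1]], ![![1, 1], ![1, 1]]]]] : Fin 3 → Fin 3 → Fin 3 → Fin 2 → Fin 2 → ℤ)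
set_option quotPrecheck false in
local notation "σLT₈" =>
  (![
    ![
      ![![![1, 1], ![1, 1]], ![![1, 1], ![1, 1]], ![![1, 1], ![1, 1]]],
      ![![![1, 1], ![1, 1]], ![![1, 1], ![1, 1]], ![![1, 1], ![1, 1]]],
      ![![![1, 1], ![1, 1]], ![![1, 1], ![1, 1]], ![![1, 1], ![1, 1]]]],
    ![
      ![![![1, 1], ![1, 1]], ![![1, 1], ![1, 1]], ![![1, 1], ![1, 1]]],
      ![![![1, 1], ![1, 1]], ![![1, 1], ![1, 1]], ![![1, 1], ![1, 1]]],
      ![![![1, 1], ![1, 1]], ![![1, 1], ![1, 1]], ![![1, 1], ![1, 1]]]],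
    ![
      ![![![1, 1], ![1, 1]], ![![1, 1], ![1, 1]], ![![1, 1], ![1, 1]]],
      ![![![1, 1], ![1, 1]], ![![1, 1], ![1, 1]], ![![1, 1], ![1, 1]]],
      ![![![1, 1], ![1, 1]], ![![1, 1], ![1, 1]], ![![1, 1], ![1, 1]]]]] : Fin 3 → Fin 3 → Fin 3 → Fin 2 → Fin 2 → ℤ)
set_option quotPrecheck false in
local notation "ν₂" => (fun x : ℕ => (if x = 0 then 0 else 1 : Fin 2))
set_option quotPrecheck false in
local notation "eI₈" =>
  (fun (s : Fin 3 × Fin 3 × Fin 3) (u : Fin (k₈ s) × Fin (n₈ s)) => eIT₈ s.1 s.2.1 s.2.2 (ν₂ u.1) (ν₂ u.2))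
set_option quotPrecheck false in
local notation "eJ₈" =>
  (fun (s : Fin 3 × Fin 3 × Fin 3) (v : Fin (k₈ s) × Fin (m₈ s)) => eJT₈ s.1 s.2.1 s.2.2 (ν₂ v.1) (ν₂ v.2))
set_option quotPrecheck false in
local notation "eL₈" =>
  (fun (s : Fin 3 × Fin 3 × Fin 3) (w : Fin (m₈ s) × Fin (n₈ s)) => eLT₈ s.1 s.2.1 s.2.2 (ν₂ w.1) (ν₂ w.2))
set_option quotPrecheck false in
local notation "σI₈" =>
  (fun (s : Fin 3 × Fin 3 × Fin 3) (u : Fin (k₈ s) × Fin (n₈ s)) => σIT₈ s.1 s.2.1 s.2.2 (ν₂ u.1) (ν₂ u.2))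
set_option quotPrecheck false in
local notation "σJ₈" =>
  (fun (s : Fin 3 × Fin 3 × Fin 3) (v : Fin (k₈ s) × Fin (m₈ s)) => σJT₈ s.1 s.2.1 s.2.2 (ν₂ v.1) (ν₂ v.2))
set_option quotPrecheck false in
local notation "σL₈" =>
  (fun (s : Fin 3 × Fin 3 × Fin 3) (w : Fin (m₈ s) × Fin (n₈ s)) => σLT₈ s.1 s.2.1 s.2.2 (ν₂ w.1) (ν₂ w.2))
-- The count vector `c` of the distribution `P = c/8`: `2` at the centre `(1,1,1)`, `1` on the other blocks.
set_option quotPrecheck false in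
local notation "c₈" =>
  (fun s : Fin 3 × Fin 3 × Fin 3 =>
    (if (s.1 : ℕ) + s.2.1 + s.2.2 = 3 then (if (s.1 : ℕ) = 1 ∧ (s.2.1 : ℕ) = 1 then 2 else 1) else 0 : ℕ))

/-! ## The weight grading: support, components, bookkeeping (kernel computations on `octTab`) -/

/-- **Outer support (integer form).** A non-zero entry of `octTab` has its label triple in `S₈`
(label sum `3`). [folklore] -/
theorem octWeight_support_int :
    ∀ a b c : Fin 2 × Fin 2 × Fin 2, octTab a b c ≠ 0 → (bI₈ a, bJ₈ b, bL₈ c) ∈ S₈ := by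
  decide

/-- **Outer support.** A non-zero entry of `t₈` has its label triple in `S₈`. [folklore] -/
theorem octWeight_support (a b c : Fin 2 × Fin 2 × Fin 2) (h : octT ℂ a b c ≠ 0) :
    (bI₈ a, bJ₈ b, bL₈ c) ∈ S₈ := by
  refine octWeight_support_int a b c fun h0 => h ?_
  rw [octT_complex_eq_octTab, h0, Int.cast_zero]

/-- The seven members of `S₈`. [folklore] -/
theorem octWeight_mem_S (s : Fin 3 × Fin 3 × Fin 3) (hs : s ∈ S₈) :
    s = (0, 1, 2) ∨ s = (0, 2, 1) ∨ s = (1, 0, 2) ∨ s = (1, 1, 1) ∨ s = (1, 2, 0) ∨ s = (2, 0, 1) ∨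
      s = (2, 1, 0) := by
  revert s; decide

/-- **Components (integer form).** Along the index maps, each component of `octTab` is the signed
matrix multiplication pattern `σI σJ σL · [u₁ = v₁][v₂ = w₁][u₂ = w₂]`. [folklore] -/
theorem octWeight_components_int :
    ∀ s ∈ S₈, ∀ (u : Fin (k₈ s) × Fin (n₈ s)) (v : Fin (k₈ s) × Fin (m₈ s)) (w : Fin (m₈ s) × Fin (n₈ s)),
      octTab (eI₈ s u) (eJ₈ s v) (eL₈ s w) =
        σI₈ s u * σJ₈ s v * σL₈ s w * (if u.1 = v.1 ∧ v.2 = w.1 ∧ u.2 = w.2 then 1 else 0) := by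
  intro s hs
  rcases octWeight_mem_S s hs with rfl | rfl | rfl | rfl | rfl | rfl | rfl <;> decide +kernel

/-- **Components.** Each component of `t₈` in the weight grading is, along the index maps `eI₈, eJ₈,
eL₈` and up to the signs `σI₈, σJ₈, σL₈`, the matrix tensor `⟨k₈ s, m₈ s, n₈ s⟩`. [folklore] -/
theorem octWeight_components :
    ∀ s ∈ S₈, ∀ (u : Fin (k₈ s) × Fin (n₈ s)) (v : Fin (k₈ s) × Fin (m₈ s)) (w : Fin (m₈ s) × Fin (n₈ s)),
      octT ℂ (eI₈ s u) (eJ₈ s v) (eL₈ s w) =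
        ((σI₈ s u : ℤ) : ℂ) * ((σJ₈ s v : ℤ) : ℂ) * ((σL₈ s w : ℤ) : ℂ) *
          matMulTensor ℂ (k₈ s) (m₈ s) (n₈ s) u v w := by
  intro s hs u v w
  rw [octT_complex_eq_octTab, octWeight_components_int s hs u v w]
  simp only [matMulTensor]
  push_cast
  split_ifs <;> simp

/-- The index maps land in the right blocks. [folklore] -/
theorem octWeight_index_blocks :
    (∀ s ∈ S₈, ∀ u : Fin (k₈ s) × Fin (n₈ s), bI₈ (eI₈ s u) = s.1) ∧
    (∀ s ∈ S₈, ∀ v : Fin (k₈ s) × Fin (m₈ s), bJ₈ (eJ₈ s v) = s.2.1) ∧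
    (∀ s ∈ S₈, ∀ w : Fin (m₈ s) × Fin (n₈ s), bL₈ (eL₈ s w) = s.2.2) := by
  refine ⟨?_, ?_, ?_⟩ <;>
  · intro s hs
    rcases octWeight_mem_S s hs with rfl | rfl | rfl | rfl | rfl | rfl | rfl <;> decide +kernel

/-- The signs square to one. [folklore] -/
theorem octWeight_signs_sq :
    (∀ s ∈ S₈, ∀ u : Fin (k₈ s) × Fin (n₈ s), σI₈ s u * σI₈ s u = 1) ∧
    (∀ s ∈ S₈, ∀ v : Fin (k₈ s) × Fin (m₈ s), σJ₈ s v * σJ₈ s v = 1) ∧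
    (∀ s ∈ S₈, ∀ w : Fin (m₈ s) × Fin (n₈ s), σL₈ s w * σL₈ s w = 1) := by
  refine ⟨?_, ?_, ?_⟩ <;>
  · intro s hs
    rcases octWeight_mem_S s hs with rfl | rfl | rfl | rfl | rfl | rfl | rfl <;> decide +kernel

/-- Formats: positive, consistent with the block dimensions `(2, 4, 2)`, and `B_c = ⟨2^6, 2^6, 2^6⟩`,
`∑ c = 8`. [folklore] -/
theorem octWeight_formats :
    (∀ s ∈ S₈, 1 ≤ k₈ s ∧ 1 ≤ m₈ s ∧ 1 ≤ n₈ s) ∧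
    (∀ s ∈ S₈, k₈ s * n₈ s = (![2, 4, 2] : Fin 3 → ℕ) s.1) ∧
    (∀ s ∈ S₈, k₈ s * m₈ s = (![2, 4, 2] : Fin 3 → ℕ) s.2.1) ∧
    (∀ s ∈ S₈, m₈ s * n₈ s = (![2, 4, 2] : Fin 3 → ℕ) s.2.2) ∧
    (∀ s, s ∉ S₈ → c₈ s = 0) ∧ (∑ s, c₈ s = 8) ∧
    (∏ s, k₈ s ^ c₈ s = 2 ^ 6) ∧ (∏ s, m₈ s ^ c₈ s = 2 ^ 6) ∧ (∏ s, n₈ s ^ c₈ s = 2 ^ 6) := by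
  refine ⟨?_, ?_, ?_, ?_, ?_, ?_, ?_, ?_, ?_⟩ <;> decide

/-- Tightness data: `α = β = γ = (· − 1) : Fin 3 → ℤ¹` is injective, bounded by `1`, and sums to zero on
`S₈`. [folklore] -/
theorem octWeight_tight :
    Function.Injective (fun (i : Fin 3) (_ : Fin 1) => ((i : ℕ) : ℤ) - 1) ∧
    (∀ (i : Fin 3) (ρ : Fin 1), |(fun (i : Fin 3) (_ : Fin 1) => ((i : ℕ) : ℤ) - 1) i ρ| ≤ (1 : ℕ)) ∧
    (∀ s ∈ S₈, ∀ ρ : Fin 1, (fun (i : Fin 3) (_ : Fin 1) => ((i : ℕ) : ℤ) - 1) s.1 ρ +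
      (fun (i : Fin 3) (_ : Fin 1) => ((i : ℕ) : ℤ) - 1) s.2.1 ρ +
      (fun (i : Fin 3) (_ : Fin 1) => ((i : ℕ) : ℤ) - 1) s.2.2 ρ = 0) := by
  refine ⟨?_, ?_, ?_⟩
  · intro i j h
    have h0 := congrFun h 0
    simp only at h0
    exact Fin.ext (by omega)
  · decide
  · decide

/-! ## The marginals and their entropy -/

/-- The three marginals of `P = c₈/8` are `(1/4, 1/2, 1/4)`. [folklore] -/
theorem octWeight_marginals :
    marginalDist₁ (fun s : Fin 3 × Fin 3 × Fin 3 => ((c₈ s : ℕ) : ℝ) / 8) = ![1/4, 1/2, 1/4] ∧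
    marginalDist₂ (fun s : Fin 3 × Fin 3 × Fin 3 => ((c₈ s : ℕ) : ℝ) / 8) = ![1/4, 1/2, 1/4] ∧
    marginalDist₃ (fun s : Fin 3 × Fin 3 × Fin 3 => ((c₈ s : ℕ) : ℝ) / 8) = ![1/4, 1/2, 1/4] := by
  refine ⟨?_, ?_, ?_⟩
  · funext i
    fin_cases i <;> simp [marginalDist₁, Fin.sum_univ_three] <;> norm_num
  · funext j
    fin_cases j <;> simp [marginalDist₂, Fin.sum_univ_three] <;> norm_num
  · funext l
    fin_cases l <;> simp [marginalDist₃, Fin.sum_univ_three] <;> norm_num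

/-- `H(1/4, 1/2, 1/4) = 3/2` bits. [folklore] -/
theorem shannonEntropy_quarter_half_quarter : shannonEntropy (![1/4, 1/2, 1/4] : Fin 3 → ℝ) = 3 / 2 := by
  have hlog2 : Real.log 2 ≠ 0 := (Real.log_pos one_lt_two).ne'
  have h4 : Real.log (1 / 4 : ℝ) = -(2 * Real.log 2) := by
    rw [one_div, Real.log_inv, show (4 : ℝ) = 2 ^ 2 by norm_num, Real.log_pow]; push_cast; ring
  have h2 : Real.log (1 / 2 : ℝ) = -Real.log 2 := by
    rw [one_div, Real.log_inv]
  rw [shannonEntropy_def, Fin.sum_univ_three]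
  simp only [Matrix.cons_val_zero, Matrix.cons_val_one, Matrix.head_cons, Matrix.cons_val_two,
    Matrix.tail_cons, Real.negMulLog, h4, h2]
  field_simp
  ring

/-! ## The weight-basis laser inequality -/

/-- **Weight-basis laser inequality for the octonion tensor**: for every universal spectral point `F`
over `ℂ`, `3/2 + (3/4) log₂ F(⟨2,2,2⟩) ≤ log₂ F(t₈)`, i.e. `2^{3/2} F(⟨2,2,2⟩)^{3/4} ≤ F(t₈)`
(the spectral laser theorem on the 7-block weight grading of `t₈` with `P = (1/4; 1/8 × 6)`).
[cite: BurgisserClausenShokrollahi1997, Thm. 15.41] -/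
theorem octWeightLaser (F : SpectralMap ℂ) (hF : IsUniversalSpectralPoint ℂ F) :
    (3/2 : ℝ) + 3/4 * Real.logb 2 (F (matMulTensor ℂ 2 2 2)) ≤ Real.logb 2 (F (octT ℂ)) := by
  obtain ⟨hpos, hdI, hdJ, hdL, hcS, hcsum, hK, hM, hN⟩ := octWeight_formats
  obtain ⟨heI, heJ, heL⟩ := octWeight_index_blocks
  obtain ⟨hsI, hsJ, hsL⟩ := octWeight_signs_sq
  obtain ⟨hαinj, hαb, htight⟩ := octWeight_tight
  have hmain := laser_spectral_of_counts (K := ℂ) (octT ℂ) bI₈ bJ₈ bL₈ S₈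
    (fun a b c h => octWeight_support a b c h)
    (r := 1) (b := 1) (fun (i : Fin 3) (_ : Fin 1) => ((i : ℕ) : ℤ) - 1)
    (fun (i : Fin 3) (_ : Fin 1) => ((i : ℕ) : ℤ) - 1) (fun (i : Fin 3) (_ : Fin 1) => ((i : ℕ) : ℤ) - 1)
    hαinj hαinj hαinj hαb hαb htight k₈ m₈ n₈ eI₈ eJ₈ eL₈
    (fun s u => ((σI₈ s u : ℤ) : ℂ)) (fun s v => ((σJ₈ s v : ℤ) : ℂ)) (fun s w => ((σL₈ s w : ℤ) : ℂ))
    heI heJ heL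
    (fun s hs u => by exact_mod_cast hsI s hs u) (fun s hs v => by exact_mod_cast hsJ s hs v)
    (fun s hs w => by exact_mod_cast hsL s hs w)
    octWeight_components hpos (![2, 4, 2]) (![2, 4, 2]) (![2, 4, 2]) hdI hdJ hdL
    c₈ hcS (d := 8) (by norm_num) hcsum (fun s => ((c₈ s : ℕ) : ℝ) / 8) (fun s => rfl) F hF
  -- evaluate the entropy and the block
  obtain ⟨hm1, hm2, hm3⟩ := octWeight_marginals
  rw [hm1, hm2, hm3, shannonEntropy_quarter_half_quarter, min_self, min_self, hK, hM, hN] at hmain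
  -- `F(⟨2^6,2^6,2^6⟩) ≥ F(⟨2,2,2⟩)^6`
  set φ : ℝ := F (matMulTensor ℂ 2 2 2) with hφ
  have hφ1 : 1 ≤ φ := one_le_spectral_of_ne_zero hF (matMulTensor_ne_zero two_pos two_pos two_pos)
  have hφ0 : 0 < φ := one_pos.trans_le hφ1
  have hB : φ ^ 6 ≤ F (matMulTensor ℂ (2 ^ 6) (2 ^ 6) (2 ^ 6)) := by
    rw [hφ, ← hF.map_kroneckerPow]
    exact hF.mono _ _ (tensorRestrictsTo_matMulTensor_pow_kroneckerPow ℂ 2 2 2 6)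
  have hlogB : 6 * Real.logb 2 φ ≤ Real.logb 2 (F (matMulTensor ℂ (2 ^ 6) (2 ^ 6) (2 ^ 6))) := by
    have e : Real.logb 2 (φ ^ 6) = 6 * Real.logb 2 φ := by
      rw [Real.logb_pow]; push_cast; ring
    rw [← e]
    exact Real.logb_le_logb_of_le one_lt_two (pow_pos hφ0 6) hB
  have hmain' : (8 : ℝ) * (3 / 2) + Real.logb 2 (F (matMulTensor ℂ (2 ^ 6) (2 ^ 6) (2 ^ 6))) ≤
      8 * Real.logb 2 (F (octT ℂ)) := by exact_mod_cast hmain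
  linarith

/-- **Stub `stub_octWeightLaser` of the crux skeleton of `OctSpectralDominance`
(stmt-MatrixMultiplication-7931, line `registered`)**, with the route's inline term for `t₈`.
[cite: BurgisserClausenShokrollahi1997, Thm. 15.41] -/
theorem stub_octWeightLaser :
    ∀ F : SpectralMap ℂ, IsUniversalSpectralPoint ℂ F → (3/2 : ℝ) + 3/4 * Real.logb 2 (F (matMulTensor ℂ 2 2 2)) ≤ Real.logb 2 (F (fun o p q : Fin 2 × Fin 2 × Fin 2 => (if o.1 = 0 ∧ p.1 = 0 ∧ q.1 = 0 then (Matrix.single p.2.1 p.2.2 (1:ℂ) * Matrix.single q.2.1 q.2.2 (1:ℂ)) o.2.1 o.2.2 else 0) - (if o.1 = 0 ∧ p.1 = 1 ∧ q.1 = 1 then ((Matrix.single q.2.1 q.2.2 (1:ℂ)).adjugate * Matrix.single p.2.1 p.2.2 (1:ℂ)) o.2.1 o.2.2 else 0) + (if o.1 = 1 ∧ p.1 = 0 ∧ q.1 = 1 then (Matrix.single q.2.1 q.2.2 (1:ℂ) * Matrix.single p.2.1 p.2.2 (1:ℂ)) o.2.1 o.2.2 else 0) + (if o.1 = 1 ∧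 p.1 = 1 ∧ q.1 = 0 then (Matrix.single p.2.1 p.2.2 (1:ℂ) * (Matrix.single q.2.1 q.2.2 (1:ℂ)).adjugate) o.2.1 o.2.2 else 0))) :=
  octWeightLaser

end Summit.MatrixMultiplication.MatrixMultiplication.Theorems

end
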